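import Literature.Barriers.CriticalPhenomena.PlaquetteWalkHoleRootExtensionCost
import Literature.Barriers.CriticalPhenomena.PlaquetteWalkAngleLimitPhase
import HarnessLib

/-!
# The configuration counts and the quarter-turn count of the class-`B2b` extension

Sequel to `PlaquetteWalkHoleRootExtensionCost`: for a class-`B2a` walk `ω` from the hole root whose first arc in the observed rhombus `r`
turns (kind `k ∈ {corner, coCorner}`), the third group member `ext₃ ω` (one more arc inside `r`, from the end side `ω.1` to the fourth
side `z₃`) has

* `ΩG.quarterTurnsL_ext₃`: `q(ext₃ ω) = q(ω) + qTurn ω.1 z₃`; `ΩG.classCount_ext₃` / `ΩG.vlCount_ext₃`: the turn-class counts of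
  `PlaquetteWalkAngleLimitPhase` gain the class of the new arc `(ω.1, z₃)`;
* `ΩG.cfgCount_ext₃_of_ne`: the same number of plaquettes in every local configuration `κ ∉ {[k], [k, k]}`;
* ★★ `ΩG.cfgCount_ext₃_single` / `ΩG.cfgCount_ext₃_pair`: one plaquette fewer in configuration `[k]` (weight `u`) and one more in
  `[k, k]` (weight `w`): `n_{[k]}(ext₃) + 1 = n_{[k]}(ω)`, `n_{[k,k]}(ω) + 1 = n_{[k,k]}(ext₃)`.

These are exactly the exponents entering `limitWeight` (`PlaquetteWalkAngleLimitCoefficient`) and the PHASE LAW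
(`PlaquetteWalkAngleLimitPhase.limitWeight_eq_phase_of_vert`), so the limit weight / phase class of a level-`5` class-`B2b` member is read
off its parent's class (b-engine-1 g24 census kit j276221/j280313: parents of cost `5` with slanted end or cost `7` with vertical end,
`cost_ext₃_eq_five_iff`). [GlazmanManolescu2019 Lemma 2.1 (proof: the groups of three walks), §1 Fig. 1, eq. (1); Glazman 2015 Lemma 3.1]
-/

noncomputable section

namespace Literature.Probability.RandomPlanarGeometry.SAW.YangBaxter

open Real
open Literature.Barriers.CriticalPhenomena.PlaquetteWalk

open private IsNS ext₃_fst ext₃_snd_arcs z₃_spec fc_fh sides_distinctG returnSide_of_isB2a from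
  Literature.Probability.RandomPlanarGeometry.YangBaxterSAWGeneralDomain

namespace ΩG

variable {D : Set Face} {w r : Face} {ω : ΩG D (w.side .W) r}

/-- ★ **QUARTER TURNS OF THE EXTENSION**: the signed quarter-turn count of `ext₃ ω` is that of `ω` plus the quarter turn of the new arc
`ω.1 → z₃` inside `r`. [cite: GlazmanManolescu2019, Lemma 2.1 (proof: the groups of three walks); §1, eq. (1)] -/
theorem quarterTurnsL_ext₃ (hr : RootedFace D (w.side .W) r) (hN : IsNS ω hr) :
    quarterTurnsL (ω.ext₃ hr).2.mids = quarterTurnsL ω.2.mids + qTurn ω.1 (ω.z₃ hr hN.1) := by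
  have hz := (z₃_spec ω hr hN.1).2.2
  have harcs : arcsOf (ω.ext₃ hr).2.mids = arcsOf ω.2.mids ++ [(r.side ω.1, r.side (ω.z₃ hr hN.1))] :=
    ext₃_snd_arcs ω hr hN
  have hq : qTurnOf (r.side ω.1, r.side (ω.z₃ hr hN.1)) = qTurn ω.1 (ω.z₃ hr hN.1) := by
    simp [qTurnOf, arcFace_side_side r _ _ hz.symm, Face.sideOf_side]
  unfold quarterTurnsL
  rw [harcs, List.map_append, List.sum_append, List.map_singleton, List.sum_singleton, hq]

/-- ★ **TURN CLASSES OF THE EXTENSION**: for any class `c` of ordered side pairs (`PlaquetteWalkAngleLimitPhase.classCount`), the extension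
has the arcs of `ω` plus the new arc `(ω.1, z₃)`: `classCount c (ext₃ ω) = classCount c ω + [c (ω.1, z₃)]`.
[cite: GlazmanManolescu2019, Lemma 2.1 (proof: the groups of three walks); §1, Fig. 1] -/
theorem classCount_ext₃ (hr : RootedFace D (w.side .W) r) (hN : IsNS ω hr) (c : Side × Side → Bool) :
    classCount c (ω.ext₃ hr).2.mids = classCount c ω.2.mids + (if c (ω.1, ω.z₃ hr hN.1) then 1 else 0) := by
  have hz := (z₃_spec ω hr hN.1).2.2
  have harcs : arcsOf (ω.ext₃ hr).2.mids = arcsOf ω.2.mids ++ [(r.side ω.1, r.side (ω.z₃ hr hN.1))] :=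
    ext₃_snd_arcs ω hr hN
  have hs : arcSides (r.side ω.1, r.side (ω.z₃ hr hN.1)) = some (ω.1, ω.z₃ hr hN.1) := by
    simp [arcSides, arcFace_side_side r _ _ hz.symm, Face.sideOf_side]
  unfold classCount
  rw [harcs, List.countP_append]
  simp [hs]

/-- `n_{VL}(ext₃ ω) = n_{VL}(ω) + [the new arc is `S → W` or `N → E`]` — the count entering the PHASE LAW
`PlaquetteWalkAngleLimitPhase.limitWeight_eq_phase_of_vert`. [cite: GlazmanManolescu2019, Lemma 2.1 (proof: the groups of three walks); §1,
Fig. 1 and eq. (1)] -/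
theorem vlCount_ext₃ (hr : RootedFace D (w.side .W) r) (hN : IsNS ω hr) :
    vlCount (ω.ext₃ hr).2.mids = vlCount ω.2.mids + (if isVL (ω.1, ω.z₃ hr hN.1) then 1 else 0) :=
  classCount_ext₃ hr hN isVL

/-- Counting over a list without repetition: two Boolean predicates that agree off one member `r`, false resp. true at `r`, have
counts differing by one. [folklore] -/
private theorem countP_succ_of_agree_off' {L : List Face} (hL : L.Nodup) {r : Face} (hr : r ∈ L) {p q : Face → Bool}
    (hpq : ∀ f ∈ L, f ≠ r → p f = q f) (hp : p r = false) (hq : q r = true) : L.countP p + 1 = L.countP q := by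
  have hperm := List.perm_cons_erase hr
  rw [hperm.countP_eq p, hperm.countP_eq q, List.countP_cons, List.countP_cons, hp, hq]
  have hagree : (L.erase r).countP p = (L.erase r).countP q :=
    List.countP_congr fun f hf => by
      have hfr : f ≠ r := by
        intro e; subst e; exact (List.Nodup.not_mem_erase hL) hf
      rw [hpq f ((List.erase_subset) hf) hfr]
  rw [hagree]
  simp

/-- The data at `r` shared by the three counting lemmas: `r` is visited, the plaquettes of the extension are those of `ω` up to order,
`kindsL ω r = [k]` and `kindsL (ext₃ ω) r = [k, k]` with `k` the kind of the first-crossing arc. [cite: GlazmanManolescu2019, Lemma 2.1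
(proof: the groups of three walks); §1, Fig. 1] -/
private theorem ext₃_data (hr : RootedFace D (w.side .W) r) (h : ω.IsB2a)
    (hNS : arcKind (ω.2.sIn ω.2.firstHitG) (ω.2.sOut ω.2.firstHitG) ≠ .straight) :
    IsNS ω hr ∧ r ∈ facesL ω.2.mids ∧ (facesL (ω.ext₃ hr).2.mids).Perm (facesL ω.2.mids) ∧
      kindsL ω.2.mids r = [arcKind (ω.2.sIn ω.2.firstHitG) (ω.2.sOut ω.2.firstHitG)] ∧
      kindsL (ω.ext₃ hr).2.mids r =
        [arcKind (ω.2.sIn ω.2.firstHitG) (ω.2.sOut ω.2.firstHitG), arcKind (ω.2.sIn ω.2.firstHitG) (ω.2.sOut ω.2.firstHitG)] := by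
  have hF := ω.fh_lt h
  obtain ⟨hfcF, hsInF, hsOutF⟩ := fc_fh ω hr h
  have hN : IsNS ω hr := ⟨h, by rw [← hsInF, ← hsOutF]; exact hNS⟩
  have hsv : ∀ j < ω.2.arcs.length, ω.2.fc j = ω.2.fc ω.2.firstHitG → j = ω.2.firstHitG :=
    fun j hj he => eq_firstHitG_of_fc_eq hr h hj he
  have hkr : kindsL ω.2.mids r = [arcKind (ω.2.sIn ω.2.firstHitG) (ω.2.sOut ω.2.firstHitG)] := by
    have e := ω.2.kindsL_eq_singleton_of_single_visit hF hsv
    rwa [hfcF] at e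
  have hmem : r ∈ facesL ω.2.mids := by
    have e := ω.2.fc_mem_facesL hF
    rwa [hfcF] at e
  -- the new arc has the same kind as the first one (it cuts the opposite corner): read off `isolatedTurns_ext₃`'s ingredients
  have hz3 := z₃_spec ω hr h
  have hd := ω.2.sides_distinctG hr h.1
  rw [ω.returnSide_of_isB2a h] at hd
  have hs0 : ω.2.sIn ω.2.firstHitG ≠ ω.1 := by rw [hsInF]; exact fun e => hd.2.1 e.symm
  have hs1 : ω.2.sOut ω.2.firstHitG ≠ ω.1 := by rw [hsOutF]; exact fun e => hd.2.2 e.symm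
  have h10 : ω.2.sIn ω.2.firstHitG ≠ ω.2.sOut ω.2.firstHitG := ω.2.sIn_ne_sOut hF
  have hz0 : ω.z₃ hr h ≠ ω.2.sIn ω.2.firstHitG := by rw [hsInF]; exact hz3.1
  have hz1 : ω.z₃ hr h ≠ ω.2.sOut ω.2.firstHitG := by rw [hsOutF]; exact hz3.2.1
  have hz2 : ω.z₃ hr h ≠ ω.1 := hz3.2.2
  have hsame : arcKind ω.1 (ω.z₃ hr h) = arcKind (ω.2.sIn ω.2.firstHitG) (ω.2.sOut ω.2.firstHitG) := by
    revert hNS h10 hs0 hs1 hz0 hz1 hz2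
    generalize ω.2.sIn ω.2.firstHitG = a; generalize ω.2.sOut ω.2.firstHitG = b
    generalize ω.1 = u; generalize ω.z₃ hr h = t
    cases a <;> cases b <;> cases u <;> cases t <;> simp (config := {decide := true})
  refine ⟨hN, hmem, facesL_ext₃_perm hr hN hmem, hkr, ?_⟩
  rw [kindsL_ext₃_self hr hN, hkr, hsame]; rfl

/-- **CONFIGURATIONS OTHER THAN `[k]`, `[k,k]` ARE EQUALLY FREQUENT** in `ω` and in its extension (`k` the kind of the first-crossing arc).
[cite: GlazmanManolescu2019, Lemma 2.1 (proof: the groups of three walks); §1, Fig. 1 and eq. (1)] -/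
theorem cfgCount_ext₃_of_ne (hr : RootedFace D (w.side .W) r) (h : ω.IsB2a)
    (hNS : arcKind (ω.2.sIn ω.2.firstHitG) (ω.2.sOut ω.2.firstHitG) ≠ .straight) {κ : List ArcKind}
    (h1 : κ ≠ [arcKind (ω.2.sIn ω.2.firstHitG) (ω.2.sOut ω.2.firstHitG)])
    (h2 : κ ≠ [arcKind (ω.2.sIn ω.2.firstHitG) (ω.2.sOut ω.2.firstHitG), arcKind (ω.2.sIn ω.2.firstHitG) (ω.2.sOut ω.2.firstHitG)]) :
    cfgCount (ω.ext₃ hr).2.mids κ = cfgCount ω.2.mids κ := by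
  obtain ⟨hN, -, hperm, hkr, hkr'⟩ := ext₃_data hr h hNS
  unfold cfgCount
  rw [hperm.countP_eq]
  exact List.countP_congr fun f _ => by
    by_cases hfr : f = r
    · rw [hfr, hkr, hkr']
      constructor
      · intro e; exact absurd (of_decide_eq_true e).symm h2
      · intro e; exact absurd (of_decide_eq_true e).symm h1
    · rw [kindsL_ext₃_of_ne hr hN hfr]

/-- ★★ **ONE `[k]`-PLAQUETTE FEWER**: `n_{[k]}(ext₃ ω) + 1 = n_{[k]}(ω)` — the rhombus `r` leaves the configuration `[k]` (weight `u₁` or `u₂`).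
[cite: GlazmanManolescu2019, Lemma 2.1 (proof: the groups of three walks); §1, Fig. 1 and eq. (1)] -/
theorem cfgCount_ext₃_single (hr : RootedFace D (w.side .W) r) (h : ω.IsB2a)
    (hNS : arcKind (ω.2.sIn ω.2.firstHitG) (ω.2.sOut ω.2.firstHitG) ≠ .straight) :
    cfgCount (ω.ext₃ hr).2.mids [arcKind (ω.2.sIn ω.2.firstHitG) (ω.2.sOut ω.2.firstHitG)] + 1 =
      cfgCount ω.2.mids [arcKind (ω.2.sIn ω.2.firstHitG) (ω.2.sOut ω.2.firstHitG)] := by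
  obtain ⟨hN, hmem, hperm, hkr, hkr'⟩ := ext₃_data hr h hNS
  unfold cfgCount
  rw [hperm.countP_eq]
  refine countP_succ_of_agree_off' (List.nodup_dedup _) hmem (fun f _ hf => by rw [kindsL_ext₃_of_ne hr hN hf]) ?_ ?_
  · rw [hkr']; simp
  · rw [hkr]; simp

/-- ★★ **ONE `[k,k]`-PLAQUETTE MORE**: `n_{[k,k]}(ω) + 1 = n_{[k,k]}(ext₃ ω)` — the rhombus `r` enters the configuration `[k, k]` (weight `w₁` or
`w₂`). [cite: GlazmanManolescu2019, Lemma 2.1 (proof: the groups of three walks); §1, Fig. 1 and eq. (1)] -/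
theorem cfgCount_ext₃_pair (hr : RootedFace D (w.side .W) r) (h : ω.IsB2a)
    (hNS : arcKind (ω.2.sIn ω.2.firstHitG) (ω.2.sOut ω.2.firstHitG) ≠ .straight) :
    cfgCount ω.2.mids [arcKind (ω.2.sIn ω.2.firstHitG) (ω.2.sOut ω.2.firstHitG), arcKind (ω.2.sIn ω.2.firstHitG) (ω.2.sOut ω.2.firstHitG)]
      + 1 = cfgCount (ω.ext₃ hr).2.mids
        [arcKind (ω.2.sIn ω.2.firstHitG) (ω.2.sOut ω.2.firstHitG), arcKind (ω.2.sIn ω.2.firstHitG) (ω.2.sOut ω.2.firstHitG)] := by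
  obtain ⟨hN, hmem, hperm, hkr, hkr'⟩ := ext₃_data hr h hNS
  unfold cfgCount
  rw [hperm.countP_eq]
  refine countP_succ_of_agree_off' (List.nodup_dedup _) hmem (fun f _ hf => by rw [kindsL_ext₃_of_ne hr hN hf]) ?_ ?_
  · rw [hkr]; simp
  · rw [hkr']; simp

end ΩG

end Literature.Probability.RandomPlanarGeometry.SAW.YangBaxter
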